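import Summits.CriticalPhenomena.SAWScalingLimit.Theorems.SAWReversalUpgradeNoDeepReturnPolylineToVertex
import Summits.CriticalPhenomena.SAWScalingLimit.Theses.SAWRenewalTightness
import Literature.Probability.RandomPlanarGeometry.SAWWordBridges
import HarnessLib

/-!
# Crux `NoDeepReturn` (stmt-CriticalPhenomena-18004) — idea `root-renewal-kesten` (round 2, ideator 4)

Sketch file: typed TRANSFER `CrosscutRenewalDensity → NoDeepReturn` (glue PROVED below, no sorry),
the single-crossing ("renewal") predicate whose masses factorise exactly, and the typed MODEL
statements in Kesten's translation-invariant world (half-plane step words of `SAWWordBridges.lean`,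
Kesten's identity = route decl `SAWRenewalTightness.KestenIdentity`, proved in tree as
`Theorems.KestenIdentity_proof`).

Nothing here is a registered stub; `sorry` appears only in the two MODEL statements of §3, which are
theorems in print (Lawler–Schramm–Werner 2004, Appendix A; Madras–Slade 1993 §8.3) recorded as
targets, not as facts.
-/

noncomputable section

namespace Summit.CriticalPhenomena.SAWScalingLimit.Cruxes.NoDeepReturn.Ideator4

open MeasureTheory Filter Topology Set Metric
open scoped ENNReal
open Literature.Probability.LatticeModels (Site meshPoint discreteDomainGraph)
open Literature.Probability.RandomPlanarGeometry
open Literature.Probability.RandomPlanarGeometry.SAW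

/-- The crux, by name. -/
abbrev Crux : Prop := Summit.CriticalPhenomena.SAWScalingLimit.Theses.SAWReversalUpgrade.NoDeepReturn

/-! ## §1 Single crossings (renewals) of a deterministic separator -/

/-- `γ` **single-crosses** the plane set `S`: for some index `k < |γ|` every vertex up to `k` is
(after scaling by `δ`) in `S` and every later vertex is outside `S`. Past `⊆ S`, future `⊆ Sᶜ`:
the two pieces cannot meet, so the `x_c`-mass of `{single-cross S at the edge (u,v)}` is the
PRODUCT `W_S(a_δ → u) · x_c · W_{Sᶜ}(v → b_δ)` (free gluing). -/
def SingleCross {Ω : Set ℂ} {δ : ℝ} {u v : Site 2} (S : Set ℂ) (γ : DomainSAW Ω δ u v) : Prop :=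
  ∃ k : ℕ, k < γ.walk.length ∧ (∀ j ≤ k, meshPoint δ (γ.walk.getVert j) ∈ S) ∧
    (∀ j, k < j → j ≤ γ.walk.length → meshPoint δ (γ.walk.getVert j) ∉ S)

/-- A **root chain** between radii `r < ε` at the prime end `a = D.pt 0`: a NESTED family of plane
sets, each containing the closed `r`-ball about `a` and contained in the open `ε`-ball. (Intended
instance: the conformal half-discs `φ(B(0,ρ) ∩ ℍ)`, `ρ ∈ (ρ₀, ρ₁)`, of a chordal uniformizer
`φ : ℍ → D`, `0 ↦ a`; or, at lattice level, any nested family of lattice layers between them.)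
Nestedness is what keeps the statement below from being the crux reworded: a non-nested family
could be taken to be ALL sets between the two balls, and then "some member is single-crossed" is
literally the complement of the deep-return event. -/
structure RootChain (D : DobrushinDomain) (ε r : ℝ) where
  /-- the chain, indexed by a real parameter -/
  S : ℝ → Set ℂ
  mono : Monotone S
  subset_ball : ∀ t, S t ⊆ ball (D.pt 0) ε
  closedBall_subset : ∀ t, closedBall (D.pt 0) r ⊆ S t

/-- **TRANSFER TARGET `C⁺` (CrosscutRenewalDensity).** For every Dobrushin domain, endpoint
approximation, `ε, η > 0` there is `r > 0` such that for all small `δ` SOME root chain between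
`r` and `ε` is single-crossed at some member with probability `≥ 1 - η`: renewal scales are dense
at the root. Stronger than the crux (`noDeepReturn_of_crosscutRenewalDensity`); its complement
event is a union over ONE-arm product events. -/
def CrosscutRenewalDensity : Prop :=
  ∀ (D : DobrushinDomain) (a b : ℝ → Site 2), IsEndpointApprox D a b →
    ∀ ε : ℝ, 0 < ε → ∀ η : ℝ, 0 < η → ∃ r : ℝ, 0 < r ∧ ∀ᶠ δ in 𝓝[>] (0 : ℝ),
      ∃ C : RootChain D ε r,
        law D.carrier δ (a δ) (b δ) {γ | ∀ t, ¬ SingleCross (C.S t) γ} ≤ ENNReal.ofReal η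

/-! ## §2 The glue (deterministic, proved): a renewal between `r` and `ε` forbids a deep return -/

/-- If `γ` single-crosses a set `S` with `B̄(c,r) ⊆ S ⊆ B(c,ε)`, then no vertex `ε`-far from `c` is
followed by a vertex `r`-close to `c`. -/
theorem not_farNear_of_singleCross {Ω : Set ℂ} {δ : ℝ} {u v : Site 2} {S : Set ℂ} {c : ℂ}
    {ε r : ℝ} (hS : S ⊆ ball c ε) (hrS : closedBall c r ⊆ S) {γ : DomainSAW Ω δ u v}
    (h : SingleCross S γ) :
    ¬ ∃ i j : ℕ, i < j ∧ j ≤ γ.walk.length ∧ ε ≤ dist (meshPoint δ (γ.walk.getVert i)) c ∧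
        dist (meshPoint δ (γ.walk.getVert j)) c ≤ r := by
  rintro ⟨i, j, hij, hj, hfar, hnear⟩
  obtain ⟨k, hk, hpre, hpost⟩ := h
  -- the near vertex `j` is in `S`, hence `j ≤ k`
  have hjS : meshPoint δ (γ.walk.getVert j) ∈ S := hrS (mem_closedBall.2 hnear)
  have hjk : j ≤ k := by
    by_contra hlt
    exact hpost j (lt_of_not_ge hlt) hj hjS
  -- the far vertex `i ≤ k` would be in `S ⊆ B(c, ε)`: contradiction
  have hiS : meshPoint δ (γ.walk.getVert i) ∈ S := hpre i (by omega)
  have : dist (meshPoint δ (γ.walk.getVert i)) c < ε := mem_ball.1 (hS hiS)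
  linarith

/-- **GLUE (proved): `CrosscutRenewalDensity → NoDeepReturn`.** With `r' := min (r/2) (ε/4)`,
for `δ < r'` the crux's polyline event at `(ε, r')` forces (landed `stub_polylineToVertex`,
p158730) a far vertex followed by an `(r' + δ)`-close, hence `r`-close, vertex, which a single
crossing of any member of a root chain between `r` and `ε` forbids. -/
theorem noDeepReturn_of_crosscutRenewalDensity (h : CrosscutRenewalDensity) : Crux := by
  intro D a b hab ε hε η hη
  obtain ⟨r, hr, hev⟩ := h D a b hab ε hε η hη
  refine ⟨min (r / 2) (ε / 4), lt_min (by linarith) (by linarith), ?_⟩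
  have hsmall : ∀ᶠ δ in 𝓝[>] (0 : ℝ), δ < min (r / 2) (ε / 4) :=
    nhdsWithin_le_nhds (Iio_mem_nhds (lt_min (by linarith) (by linarith)))
  have hpos : ∀ᶠ δ in 𝓝[>] (0 : ℝ), 0 < δ := eventually_mem_nhdsWithin
  filter_upwards [hev, hsmall, hpos] with δ ⟨C, hC⟩ hδ hδ0
  refine le_trans (measure_mono fun γ hγ => ?_) hC
  simp only [mem_setOf_eq] at hγ ⊢
  intro t hcross
  have hrε : min (r / 2) (ε / 4) + δ < ε := by
    have := min_le_right (r / 2) (ε / 4)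
    linarith
  obtain ⟨i, j, hij, hj, hfar, hnear⟩ :=
    Theorems.NoDeepReturn.NakedRoot.stub_polylineToVertex D.carrier δ (a δ) (b δ) γ (D.pt 0) ε
      (min (r / 2) (ε / 4)) hδ0 hrε hγ
  have hnear' : dist (meshPoint δ (γ.walk.getVert j)) (D.pt 0) ≤ r := by
    have := min_le_left (r / 2) (ε / 4)
    linarith
  exact not_farNear_of_singleCross (C.subset_ball t) (C.closedBall_subset t) hcross
    ⟨i, j, hij, hj, hfar, hnear'⟩

/-! ## §3 Kesten's world: the model statements (theorems in print, targets here)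

Step words `w : List Step` from the origin (`SAWWords.lean`), first coordinate `xAt w i`
(`SAWWordBridges.lean`); the "height" is the first coordinate, as in Madras–Slade / LSW04 App. A. -/

/-- Half-space word of length `n` (LSW04 App. A, `Υₙ`): self-avoiding, `xAt w i > 0` for
`1 ≤ i ≤ n`. -/
def IsHalfSpaceWord (w : List Step) : Prop := IsSAW w ∧ ∀ i, 1 ≤ i → i ≤ w.length → 0 < xAt w i

/-- `j` is a **renewal time** of `w` (LSW04 App. A): `1 ≤ j < |w|`, `xAt w k ≤ xAt w j` for
`k ≤ j` and `xAt w j < xAt w m` for `j < m ≤ |w|`. Past below, future strictly above: a renewal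
is a single crossing of the level `xAt w j + 1/2`. -/
def IsRenewalTime (w : List Step) (j : ℕ) : Prop :=
  1 ≤ j ∧ j < w.length ∧ (∀ k ≤ j, xAt w k ≤ xAt w j) ∧ (∀ m, j < m → m ≤ w.length → xAt w j < xAt w m)

open Classical in
/-- The `n`-step half-space words. -/
def halfSpaceWords (n : ℕ) : Finset (List Step) := (sawWords n).filter IsHalfSpaceWord

open Classical in
/-- **MODEL THEOREM M1 (Kesten 1963 + LSW04 Appendix A; Madras–Slade §8.3): early renewal.**
For every `η > 0` there is `K` such that for all large `n` the fraction of `n`-step half-space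
words with NO renewal time `≤ K` is `≤ η` — because `P_n(least renewal = k) → λ_k μ^{-k}` and
Kesten's identity `Σ_k λ_k μ^{-k} = 1` (`SAWRenewalTightness.KestenIdentity`, proved in tree).
After a renewal at time `j ≤ K` the walk never returns to first coordinate `≤ xAt w j`, in
particular never to the root's column: ROOT TRANSIENCE in the half-plane with no a-priori estimate.
[cite: LawlerSchrammWerner2004SAW, Appendix A] -/
theorem halfSpace_earlyRenewal :
    ∀ η : ℝ, 0 < η → ∃ K : ℕ, ∀ᶠ n in atTop,
      (((halfSpaceWords n).filter fun w => ∀ j ≤ K, ¬ IsRenewalTime w j).card : ℝ)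
        ≤ η * (halfSpaceWords n).card := by
  sorry

open Classical in
/-- **COROLLARY M1' (root-column transience, lattice-local regime, model case).** For every
`η > 0` there is `K` such that for all large `n`, among `n`-step half-space words the fraction
that visit first coordinate `≤ 1` at some time `> K` is `≤ η`. (Immediate from M1: a renewal at
`j ≤ K` has `xAt w j ≥ 1`, and all later first coordinates exceed it.) -/
theorem halfSpace_rootColumnTransience :
    ∀ η : ℝ, 0 < η → ∃ K : ℕ, ∀ᶠ n in atTop,
      (((halfSpaceWords n).filter fun w => ∃ m, K < m ∧ m ≤ w.length ∧ xAt w m ≤ 1).card : ℝ)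
        ≤ η * (halfSpaceWords n).card := by
  sorry

/-- Sanity link to the tree: Kesten's identity is available BY NAME as the route decl
`SAWRenewalTightness.KestenIdentity` (proved: `Theorems.KestenIdentity_proof`, file
`Theorems/SAWRenewalTightnessKestenIdentity.lean`, not imported here to keep the sketch light). -/
example : Prop := Summit.CriticalPhenomena.SAWScalingLimit.Theses.SAWRenewalTightness.KestenIdentity

end Summit.CriticalPhenomena.SAWScalingLimit.Cruxes.NoDeepReturn.Ideator4

end
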